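import Mathlib.Topology.MetricSpace.Holder
import Literature.Probability.RandomPlanarGeometry.SLE
import Literature.Probability.RandomPlanarGeometry.SLEDerivativeEstimates
import Literature.Probability.RandomPlanarGeometry.ConformalRemovability
import Literature.Probability.RandomPlanarGeometry.CaratheodoryHalfPlane
import HarnessLib

/-!
# Hölder continuity of the inverse SLE maps, `κ ≠ 4` (Rohde–Schramm 2005, Thm 5.2)

Named facts (statements only) from S. Rohde, O. Schramm, *Basic properties of SLE*, Ann. of Math.
161 (2005) 883–924 [RohdeSchramm2005] (= arXiv:math/0106036, held; numbering there: Thm 11, Cor 12,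
display (5.1)):

* **Theorem 5.2 (Hölder continuity)** (arXiv Thm 11, read verbatim): *"For every `κ ≠ 4` there is
  some `h(κ) > 0` such that for every bounded set `A ⊂ ℍ` and every `t > 0`, a.s. `f̂ₜ` is Hölder
  continuous with exponent `h(κ)` on `A`, `|f̂ₜ(z) - f̂ₜ(z')| ≤ C |z - z'|^{h(κ)}` for all
  `z, z' ∈ A`, where `C = C(ω, t, A)` is random and may depend on `t` and `A`. Moreover
  `lim_{κ↘0} h(κ) = 1/2` and `lim_{κ↗∞} h(κ) = 1`."* Here `f̂ₜ(z) = fₜ(z + ξ(t))`, `fₜ = gₜ⁻¹`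
  (§2.1, p. 887) — the tree's `Loewner.fHat` (`SLEDerivativeEstimates.lean`), with the SLE_κ driving
  function `ξ = √κ B` on the canonical space (`sleDriving κ ω`, `(ℝ≥0 → ℝ, preWienerMeasure)`,
  `SLE.lean`). Fact `RohdeSchramm2005_thm52` (the "moreover" limits are not stated).
* **The global consequence used in the proof of Cor. 5.3** (arXiv Cor. 12: `dim ∂Kₜ < 2`; ibid.
  display (5.1): "for every `t` a.s. `|f̂ₜ(z) - f̂ₜ(z')| ≤ C(ω,t) max(|z-z'|, |z-z'|^{h(κ)})`", and
  in the proof of the corollary: "Consider the conformal map `T(z) = (z-i)/(z+i)` from `ℍ` onto `𝕌`.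
  By (5.1), `T ∘ fₜ ∘ T⁻¹` is a.s. Hölder continuous in `𝕌`"): for every `t > 0`, almost surely the
  Cayley image of the Loewner domain `Hₜ = ℍ ∖ Kₜ` is a HÖLDER DOMAIN in the sense of Jones–Smirnov
  (`IsHolderDomain`, `ConformalRemovability.lean`: some conformal equivalence from the unit disc onto
  it is Hölder on the disc — here `T ∘ fₜ ∘ T⁻¹`, `fₜ : ℍ → Hₜ` conformal onto, `Loewner.domain`).
  Fact `RohdeSchramm2005_isHolderDomain_cayley_domain`. This is the form consumed together with
  `JonesSmirnov2000_frontier_of_isHolderDomain` (Cor. 2: boundaries of Hölder domains are conformally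
  removable) and conformal invariance of removability (`IsConformallyRemovableIn.image_conformalEquiv`)
  to get the a.s. removability of SLE_κ traces, `κ < 4` — the "Literature fact wanted" of route item
  `Summit.CriticalPhenomena.SAWScalingLimit.Theses.SAWWeldingIdentification.SLERemovableChord`
  (stmt-CriticalPhenomena-4506), whose remaining content is the trace/boundary bookkeeping
  (`γ[0,t] ⊆ ∂Hₜ` for the simple phase `κ ≤ 4`, RS05 Thm 6.1 = tree `ae_isSimpleTrace_sleTrace_of_le_four`,
  and a countable exhaustion in `t`).

Conventions. `κ ≠ 0` is assumed besides `κ ≠ 4` (the paper's standing `κ > 0` in §3; `κ = 0` is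
trivial but excluded to stay within the printed hypotheses). "a.s." is `∀ᵐ ω ∂preWienerMeasure`
AFTER `A` and `t` are fixed, exactly as printed (the null set may depend on them). Hölder continuity
is Mathlib's `HolderOnWith C h f A`. Not here: the values/limits of `h(κ)`, Cor. 5.3 itself
(`dim ∂Kₜ < 2`), the case `κ = 4` (believed false by the authors, p. 12 of the arXiv text).
-/

noncomputable section

namespace Literature.Probability.RandomPlanarGeometry

open MeasureTheory
open UpperHalfPlane (upperHalfPlaneSet)
open scoped NNReal

/-- **Rohde–Schramm 2005, Theorem 5.2 (Hölder continuity of `f̂ₜ`)** (arXiv:math/0106036 Thm 11,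
verbatim in the module docstring): for `κ ≠ 4` (and `κ ≠ 0`) there is `h = h(κ) > 0` such that for
every bounded `A ⊆ ℍ` and every `t > 0`, for `preWienerMeasure`-a.e. `ω`, the map
`f̂ₜ = Loewner.fHat (sleDriving κ ω) t` is Hölder continuous with exponent `h` on `A` (random
constant `C = C(ω, t, A)`). Users take `(h : RohdeSchramm2005_thm52)`.
[cite: RohdeSchramm2005, Thm 5.2 (arXiv Thm 11)] -/
def RohdeSchramm2005_thm52 : Prop :=
  ∀ κ : ℝ≥0, κ ≠ 0 → κ ≠ 4 → ∃ h : ℝ≥0, 0 < h ∧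
    ∀ A : Set ℂ, Bornology.IsBounded A → A ⊆ upperHalfPlaneSet → ∀ t : ℝ≥0, 0 < t →
      ∀ᵐ ω ∂Process.preWienerMeasure, ∃ C : ℝ≥0, HolderOnWith C h (Loewner.fHat (sleDriving κ ω) t) A

/-- **Rohde–Schramm 2005, proof of Cor. 5.3 via (5.1)** ("By (5.1), `T ∘ fₜ ∘ T⁻¹` is a.s.
Hölder continuous in `𝕌`", `T(z) = (z-i)/(z+i)`; arXiv Cor. 12): for `κ ≠ 4` (and `κ ≠ 0`) and
every `t > 0`, for `preWienerMeasure`-a.e. `ω` the Cayley image `T(Hₜ)` of the Loewner domain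
`Hₜ = ℍ ∖ Kₜ` of SLE_κ (`Loewner.domain (sleDriving κ ω) t`, `cayleyFun`) is a Hölder domain
(`IsHolderDomain`: a conformal equivalence from the unit disc onto it, Hölder on the disc).
Users take `(h : RohdeSchramm2005_isHolderDomain_cayley_domain)`.
[cite: RohdeSchramm2005, Cor 5.3 (proof, display (5.1); arXiv Cor 12)] -/
def RohdeSchramm2005_isHolderDomain_cayley_domain : Prop :=
  ∀ κ : ℝ≥0, κ ≠ 0 → κ ≠ 4 → ∀ t : ℝ≥0, 0 < t →
    ∀ᵐ ω ∂Process.preWienerMeasure,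
      IsHolderDomain (cayleyFun '' Loewner.domain (sleDriving κ ω) t)

end Literature.Probability.RandomPlanarGeometry

end
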